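import Summits.Ventures.PercRepro.RankLevelSetCrossStep
import Summits.Ventures.PercRepro.RankLevelSetFrameQ

/-!
# PercRepro — C-025: THE ORDERED CERTIFICATE (night-1, gen 8)

Unrolling the single-element identity (6.1) along an ORDERING `x₁, …, xₙ` of the ground set gives the exact
identity

  `#Y_M(p+1, q+1) = Σ_j #Y_{N_j}(p, q)`,   `N_j := (M ＼ {x₁, …, x_{j−1}}) ／ {x_j}`

(every nonempty `A ⊆ E` is `A = {x_j} ∪ A'` with `x_j = min A`; its rank in `M` is the rank of `A'` in `N_j` plus
one; the deleted prefix never meets `A'`).  Since `#Y_N(p, q) = W_{q+1}(N) + #Y_N(p, q+1)` (`q + 2 ≤ p`), the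
induction hypothesis C-025 on the proper minors `N_j` (at `(p, q+1)`, or at `(p, q)`) turns every summand into an
explicit count of `M`:

  **`RLS_of_chainSum`** — if `Φ(p+1, q+1)·#U_M(p+1, q+1) ≤ Σ_j c(N_j)` for a per-minor bound `c` with
  `c(N) ≤ #Y_N(p, q)` on every proper minor, then `RLS M (p+1) (q+1)`;
  **`RLS_of_chainCertA`** — the bound `c_A(N) = W_{q+1}(N) + Φ(p, q+1)·#U_N(p, q+1)` (C-025 at `(p, q+1)`);
  **`RLS_of_chainCertAB`** — the bound `c_AB(N) = max(c_A(N), Φ(p, q)·#U_N(p, q))` (C-025 at both cells).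

No deletion slack enters: the ordered certificate is a SINGLE inequality between counts of `M`, and the whole
induction hypothesis it needs is C-025 on smaller matroids.  Census (night-1 g8, mining/night-1/g8/): cert AB holds
for SOME ordering on every simple coloop-free matroid with ≤ 9 elements strictly above the tight layer, at every
cell (cert A alone fails only on the direct sums `U_{3,4} ⊕ U_{3,4}` at `(6, 1)` and three cores at `(7, 1)`);
on `U_{p, p+q+1}` cert AB holds for `q ≤ 13` and fails from `(20, 14)` — the certificate is a ROW OF EVIDENCE
and a kernel bridge, not a proof of the general case.  Axioms: standard.
-/

open scoped Matroid

namespace PercRepro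

namespace Matroid

open Set

variable {α : Type}

/-- The sum of a per-minor quantity `c` over the chain minors `N_j = (M ＼ {x₁, …, x_{j−1}}) ／ {x_j}` of a list:
`chainSum c M [] = 0`, `chainSum c M (x :: l) = c (M ／ {x}) + chainSum c (M ＼ {x}) l`. -/
noncomputable def chainSum (c : _root_.Matroid α → ℚ) : _root_.Matroid α → List α → ℚ
  | _, [] => 0
  | M, x :: l => c (M ／ {x}) + chainSum c (M ＼ {x}) l

/-- The middle counts `#Y_{N_j}(p, q)` summed along the chain of a list. -/
noncomputable def chainMid (p q : ℕ) : _root_.Matroid α → List α → ℕ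
  | _, [] => 0
  | M, x :: l => midCount (M ／ {x}) p q + chainMid p q (M ＼ {x}) l

/-- `chainSum` of the empty list is `0`. -/
@[simp] lemma chainSum_nil (c : _root_.Matroid α → ℚ) (M : _root_.Matroid α) : chainSum c M [] = 0 := rfl

/-- `chainSum` unfolds along a cons: the head's contraction, then the chain of the deletion. -/
@[simp] lemma chainSum_cons (c : _root_.Matroid α → ℚ) (M : _root_.Matroid α) (x : α) (l : List α) :
    chainSum c M (x :: l) = c (M ／ {x}) + chainSum c (M ＼ {x}) l := rfl

/-- `chainMid` of the empty list is `0`. -/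
@[simp] lemma chainMid_nil (p q : ℕ) (M : _root_.Matroid α) : chainMid p q M [] = 0 := rfl

/-- `chainMid` unfolds along a cons. -/
@[simp] lemma chainMid_cons (p q : ℕ) (M : _root_.Matroid α) (x : α) (l : List α) :
    chainMid p q M (x :: l) = midCount (M ／ {x}) p q + chainMid p q (M ＼ {x}) l := rfl

/-- A matroid with empty ground set has no set of rank `> q + 1`. -/
lemma midCount_eq_zero_of_ground_empty (M : _root_.Matroid α) (hE : M.E = ∅) (p q : ℕ) :
    midCount M (p + 1) (q + 1) = 0 := by
  unfold midCount
  have h : {A : Set α | A ⊆ M.E ∧ ((q + 1 : ℕ) : ℕ∞) < M.eRk A ∧ M.eRk A < ((p + 1 : ℕ) : ℕ∞)} = ∅ := by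
    rw [Set.eq_empty_iff_forall_notMem]
    rintro A ⟨hA, h1, -⟩
    rw [hE, Set.subset_empty_iff] at hA
    subst hA
    rw [_root_.Matroid.eRk_empty] at h1
    exact absurd h1 (by simp)
  rw [h, Set.ncard_empty]

/-- **THE ORDERED IDENTITY**: for a finite matroid whose ground set is listed without repetition by `l`, all of
whose elements are non-loops, `#Y_M(p+1, q+1) = Σ_j #Y_{N_j}(p, q)` along the chain of `l`. -/
theorem midCount_eq_chainMid (p q : ℕ) :
    ∀ (l : List α) (M : _root_.Matroid α) [M.Finite], l.Nodup → M.E = {x | x ∈ l} →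
      (∀ x ∈ l, M.Indep {x}) → midCount M (p + 1) (q + 1) = chainMid p q M l := by
  intro l
  induction l with
  | nil =>
    intro M _ _ hE _
    rw [chainMid_nil]
    apply midCount_eq_zero_of_ground_empty
    rw [hE]
    ext x
    simp
  | cons x l ih =>
    intro M _ hl hE hnl
    rw [List.nodup_cons] at hl
    have hx : M.Indep {x} := hnl x List.mem_cons_self
    rw [chainMid_cons, midCount_delete_contract_identity hx p q, add_comm]
    congr 1
    refine ih (M ＼ {x}) hl.2 ?_ ?_
    · rw [_root_.Matroid.delete_ground, hE]
      ext y
      simp only [Set.mem_sdiff, Set.mem_setOf_eq, List.mem_cons, Set.mem_singleton_iff]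
      constructor
      · rintro ⟨h1 | h1, h2⟩
        · exact absurd h1 h2
        · exact h1
      · intro hy
        exact ⟨Or.inr hy, fun hyx => hl.1 (hyx ▸ hy)⟩
    · intro y hy
      rw [_root_.Matroid.delete_indep_iff]
      refine ⟨hnl y (List.mem_cons_of_mem x hy), ?_⟩
      rw [Set.disjoint_singleton]
      intro hyx
      exact hl.1 (hyx ▸ hy)

/-- A per-minor bound `c N ≤ #Y_N(p, q)` on every proper minor bounds the chain sum by the chain middle count. -/
theorem chainSum_le_chainMid (c : _root_.Matroid α → ℚ) (p q : ℕ) :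
    ∀ (l : List α) (M : _root_.Matroid α) [M.Finite], l.Nodup → (∀ x ∈ l, x ∈ M.E) →
      (∀ (N : _root_.Matroid α) [N.Finite], N.E.ncard < M.E.ncard → c N ≤ (midCount N p q : ℚ)) →
      chainSum c M l ≤ (chainMid p q M l : ℚ) := by
  intro l
  induction l with
  | nil =>
    intro M _ _ _ _
    simp
  | cons x l ih =>
    intro M _ hl hE hc
    rw [List.nodup_cons] at hl
    have hxE : x ∈ M.E := hE x List.mem_cons_self
    have hlt : (M ＼ {x}).E.ncard < M.E.ncard := by
      rw [_root_.Matroid.delete_ground]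
      exact Set.ncard_sdiff_singleton_lt_of_mem hxE M.ground_finite
    have hltc : (M ／ {x}).E.ncard < M.E.ncard := by
      rw [_root_.Matroid.contract_ground]
      exact Set.ncard_sdiff_singleton_lt_of_mem hxE M.ground_finite
    rw [chainSum_cons, chainMid_cons]
    push_cast
    refine add_le_add (hc (M ／ {x}) hltc) ?_
    refine ih (M ＼ {x}) hl.2 ?_ ?_
    · intro y hy
      rw [_root_.Matroid.delete_ground]
      exact ⟨hE y (List.mem_cons_of_mem x hy), fun hyx => hl.1 (hyx ▸ hy)⟩
    · intro N _ hN
      exact hc N (lt_trans hN hlt)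

/-- **THE ORDERED BRIDGE**: if the elements of `M` are listed by `l`, every element is a non-loop, a per-minor
bound `c` is valid on all proper minors (`c N ≤ #Y_N(p, q)`), and `Φ(p+1, q+1)·#U_M(p+1, q+1) ≤ Σ_j c(N_j)`, then
C-025 holds for `M` at `(p+1, q+1)`. -/
theorem RLS_of_chainSum (M : _root_.Matroid α) [M.Finite] (p q : ℕ) (c : _root_.Matroid α → ℚ)
    (l : List α) (hl : l.Nodup) (hE : M.E = {x | x ∈ l}) (hnl : ∀ x ∈ l, M.Indep {x})
    (hc : ∀ (N : _root_.Matroid α) [N.Finite], N.E.ncard < M.E.ncard → c N ≤ (midCount N p q : ℚ))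
    (hcert : phiK (p + 1) (q + 1) * (topCount M (p + 1) (q + 1) : ℚ) ≤ chainSum c M l) :
    ThmN.RLS M (p + 1) (q + 1) := by
  rw [ThmN.RLS_iff]
  refine le_trans hcert ?_
  rw [midCount_eq_chainMid p q l M hl hE hnl]
  exact chainSum_le_chainMid c p q l M hl (fun x hx => hE ▸ hx) hc

/-- `#Y_N(p, q) = W_{q+1}(N) + #Y_N(p, q+1)` for `q + 2 ≤ p`. -/
theorem midCount_eq_levelCount_add_midCount (N : _root_.Matroid α) [N.Finite] {p q : ℕ} (h : q + 2 ≤ p) :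
    midCount N p q = levelCount N (q + 1) + midCount N p (q + 1) := by
  rw [midCount_eq_sum p q (by omega), midCount_eq_sum p (q + 1) (by omega)]
  have hI : Finset.Ioo q p = insert (q + 1) (Finset.Ioo (q + 1) p) := by
    ext u
    simp only [Finset.mem_Ioo, Finset.mem_insert]
    omega
  rw [hI, Finset.sum_insert (by simp)]

/-- The per-minor bound of certificate A: `c_A(N) = W_{q+1}(N) + Φ(p, q+1)·#U_N(p, q+1)`. -/
noncomputable def certA (p q : ℕ) (N : _root_.Matroid α) : ℚ :=
  (levelCount N (q + 1) : ℚ) + phiK p (q + 1) * (topCount N p (q + 1) : ℚ)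

/-- The per-minor bound of certificate AB: `c_AB(N) = max (c_A N) (Φ(p, q)·#U_N(p, q))`. -/
noncomputable def certAB (p q : ℕ) (N : _root_.Matroid α) : ℚ :=
  max (certA p q N) (phiK p q * (topCount N p q : ℚ))

/-- `c_A(N) ≤ #Y_N(p, q)` from C-025 for `N` at `(p, q+1)`. -/
theorem certA_le_midCount (N : _root_.Matroid α) [N.Finite] {p q : ℕ} (h : q + 2 ≤ p)
    (hN : ThmN.RLS N p (q + 1)) : certA p q N ≤ (midCount N p q : ℚ) := by
  unfold certA
  rw [midCount_eq_levelCount_add_midCount N h]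
  rw [ThmN.RLS_iff] at hN
  push_cast
  linarith

/-- `c_AB(N) ≤ #Y_N(p, q)` from C-025 for `N` at `(p, q+1)` and at `(p, q)`. -/
theorem certAB_le_midCount (N : _root_.Matroid α) [N.Finite] {p q : ℕ} (h : q + 2 ≤ p)
    (hN : ThmN.RLS N p (q + 1)) (hN' : ThmN.RLS N p q) : certAB p q N ≤ (midCount N p q : ℚ) := by
  unfold certAB
  rw [ThmN.RLS_iff] at hN'
  exact max_le (certA_le_midCount N h hN) hN'

/-- **C-025 FROM CERTIFICATE A**: `Φ(p+1, q+1)·#U_M(p+1, q+1) ≤ Σ_j [W_{q+1}(N_j) + Φ(p, q+1)·#U_{N_j}(p, q+1)]`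
along some ordering, with C-025 at `(p, q+1)` on the smaller matroids, gives `RLS M (p+1) (q+1)`. -/
theorem RLS_of_chainCertA (M : _root_.Matroid α) [M.Finite] {p q : ℕ} (h : q + 2 ≤ p)
    (l : List α) (hl : l.Nodup) (hE : M.E = {x | x ∈ l}) (hnl : ∀ x ∈ l, M.Indep {x})
    (hIH : ∀ (N : _root_.Matroid α) [N.Finite], N.E.ncard < M.E.ncard → ThmN.RLS N p (q + 1))
    (hcert : phiK (p + 1) (q + 1) * (topCount M (p + 1) (q + 1) : ℚ) ≤ chainSum (certA p q) M l) :
    ThmN.RLS M (p + 1) (q + 1) :=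
  RLS_of_chainSum M p q (certA p q) l hl hE hnl (fun N _ hN => certA_le_midCount N h (hIH N hN)) hcert

/-- **C-025 FROM CERTIFICATE AB**: the same with the per-minor maximum of the two cells `(p, q+1)`, `(p, q)`. -/
theorem RLS_of_chainCertAB (M : _root_.Matroid α) [M.Finite] {p q : ℕ} (h : q + 2 ≤ p)
    (l : List α) (hl : l.Nodup) (hE : M.E = {x | x ∈ l}) (hnl : ∀ x ∈ l, M.Indep {x})
    (hIH : ∀ (N : _root_.Matroid α) [N.Finite], N.E.ncard < M.E.ncard → ThmN.RLS N p (q + 1))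
    (hIH' : ∀ (N : _root_.Matroid α) [N.Finite], N.E.ncard < M.E.ncard → ThmN.RLS N p q)
    (hcert : phiK (p + 1) (q + 1) * (topCount M (p + 1) (q + 1) : ℚ) ≤ chainSum (certAB p q) M l) :
    ThmN.RLS M (p + 1) (q + 1) :=
  RLS_of_chainSum M p q (certAB p q) l hl hE hnl
    (fun N _ hN => certAB_le_midCount N h (hIH N hN) (hIH' N hN)) hcert

end Matroid

end PercRepro
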